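import Mathlib
import HarnessLib
import Summits.KontsevichZagierPeriods.KontsevichZagierPeriods.Theses.LinRedNormalForm
import Summits.KontsevichZagierPeriods.KontsevichZagierPeriods.Theorems.LinRedNormalFormDihedralNormalFormStubTorusDescentAux1
import Summits.KontsevichZagierPeriods.KontsevichZagierPeriods.Theorems.LinRedNormalFormDihedralNormalFormStubAtomUncrossThree

/-!
# `DihedralNormalForm`, line `torus-descent-sum-shadow`: unnesting in dimension three, I (the 1b moves)

Support file for the stub `stub_unnesting_three` (= the residual stub `stub_unnesting` of the crux
`DihedralNormalForm`, stmt-KontsevichZagierPeriods-3912, in dimension `k = 3`). A cubical atom of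
dimension three is `[□³, q · atomFun a e]`, `atomFun a e x = x₀^{a₀} x₁^{a₁} x₂^{a₂} · y₀^{e₀₀} y₀₁^{e₀₁}
y₀₂^{e₀₂} y₁^{e₁₁} y₁₂^{e₁₂} y₂^{e₂₂}` with `y_I = 1 - x_I` (`atomFun_three`). This file proves that a
dominated piece of an atom is again an integral representation and packages the five always-legal
rule-1b splits of the unnesting algorithm as KZ relations between atoms in the registered format:
`y₀₁ = y₀ + x₀y₁`, `y₁₂ = y₂ + x₂y₁` (binomial expansion of numerator crossing chords), `x₀ + y₀ = 1`,
`x₂ + y₂ = 1`, `x₁x₂ + y₁₂ = 1` (shifts; the last one is the registered tool stub `atomShiftThree12`).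
Every piece is dominated by its parent, so absolute convergence is inherited.

References: M. Kontsevich, D. Zagier, *Periods* (2001), §1.2 (rule (1)).
-/

noncomputable section

open MeasureTheory Set
open Literature.ModelTheory.ExponentialFields (IsSemialgebraic)

namespace Summit.KontsevichZagierPeriods.DihedralNormalForm.TorusDescent

open Literature.NumberTheory.Transcendental
open Literature.ModelTheory.ExponentialFields

/-! ### Positivity on the open cube -/

section cube

variable {x : Fin 3 → ℝ} (hx : ∀ i, x i ∈ Set.Ioo (0:ℝ) 1)
include hx

/-- `1 - xᵢ > 0` on the open cube. [folklore] -/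
theorem one_sub_coord_pos (i : Fin 3) : 0 < 1 - x i := sub_pos.2 (hx i).2

/-- `1 - xᵢxⱼ > 0` on the open cube. [folklore] -/
theorem one_sub_mul_pos (i j : Fin 3) : 0 < 1 - x i * x j := by
  have := mul_lt_one_of_nonneg_of_lt_one_left (hx i).1.le (hx i).2 (hx j).2.le
  linarith

/-- `1 - x₀x₁x₂ > 0` on the open cube. [folklore] -/
theorem one_sub_mul3_pos : 0 < 1 - x 0 * x 1 * x 2 := by
  have h01 : x 0 * x 1 < 1 := mul_lt_one_of_nonneg_of_lt_one_left (hx 0).1.le (hx 0).2 (hx 1).2.le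
  have : x 0 * x 1 * x 2 < 1 :=
    mul_lt_one_of_nonneg_of_lt_one_left (mul_nonneg (hx 0).1.le (hx 1).1.le) h01 (hx 2).2.le
  linarith

/-- The atom integrand of dimension three is positive on the open cube. [folklore] -/
theorem atomFun_three_pos (a : Fin 3 → ℕ) (e : Fin 3 → Fin 3 → ℤ) : 0 < atomFun a e x := by
  rw [atomFun_three]
  have h0 := (hx 0).1; have h1 := (hx 1).1; have h2 := (hx 2).1
  have g0 := one_sub_coord_pos hx 0; have g1 := one_sub_coord_pos hx 1; have g2 := one_sub_coord_pos hx 2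
  have g01 := one_sub_mul_pos hx 0 1; have g12 := one_sub_mul_pos hx 1 2
  have g02 := one_sub_mul3_pos hx
  positivity

end cube

/-! ### The pointwise identities of the five moves -/

section identities

variable (a : Fin 3 → ℕ) (e : Fin 3 → Fin 3 → ℤ) {x : Fin 3 → ℝ} (hx : ∀ i, x i ∈ Set.Ioo (0:ℝ) 1)
include hx

/-- `y₀₁ = y₀ + x₀y₁` on the atom integrand. [folklore] -/
theorem atomFun_split_n01 : atomFun a e x = atomFun a (fun i j => e i j + (if i = 0 ∧ j = 0 then 1 else if i = 0 ∧ j = 1 then -1 else 0)) x + atomFun (fun i => a i + (if i = 0 then 1 else 0)) (fun i j => e i j + (if i = 1 ∧ j = 1 then 1 else if i = 0 ∧ j = 1 then -1 else 0)) x := by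
  have g0 := (one_sub_coord_pos hx 0).ne'; have g1 := (one_sub_coord_pos hx 1).ne'
  have g2 := (one_sub_coord_pos hx 2).ne'
  have g01 := (one_sub_mul_pos hx 0 1).ne'; have g12 := (one_sub_mul_pos hx 1 2).ne'
  simp only [atomFun_three]
  simp
  rw [show e 0 1 + -1 = e 0 1 - 1 from by ring, zpow_sub_one₀ g01, zpow_add_one₀ g0, zpow_add_one₀ g1]
  field_simp
  ring

/-- `y₁₂ = y₂ + x₂y₁` on the atom integrand. [folklore] -/
theorem atomFun_split_n12 : atomFun a e x = atomFun a (fun i j => e i j + (if i = 2 ∧ j = 2 then 1 else if i = 1 ∧ j = 2 then -1 else 0)) x + atomFun (fun i => a i + (if i = 2 then 1 else 0)) (fun i j => e i j + (if i = 1 ∧ j = 1 then 1 else if i = 1 ∧ j = 2 then -1 else 0)) x := by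
  have g0 := (one_sub_coord_pos hx 0).ne'; have g1 := (one_sub_coord_pos hx 1).ne'
  have g2 := (one_sub_coord_pos hx 2).ne'
  have g01 := (one_sub_mul_pos hx 0 1).ne'; have g12 := (one_sub_mul_pos hx 1 2).ne'
  simp only [atomFun_three]
  simp
  rw [show e 1 2 + -1 = e 1 2 - 1 from by ring, zpow_sub_one₀ g12, zpow_add_one₀ g2, zpow_add_one₀ g1]
  field_simp
  ring

/-- `x₀ + y₀ = 1` on the atom integrand. [folklore] -/
theorem atomFun_split_s00 : atomFun a e x = atomFun (fun i => a i + (if i = 0 then 1 else 0)) e x + atomFun a (fun i j => e i j + (if i = 0 ∧ j = 0 then 1 else 0)) x := by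
  have g0 := (one_sub_coord_pos hx 0).ne'; have g1 := (one_sub_coord_pos hx 1).ne'
  have g2 := (one_sub_coord_pos hx 2).ne'
  have g01 := (one_sub_mul_pos hx 0 1).ne'; have g12 := (one_sub_mul_pos hx 1 2).ne'
  simp only [atomFun_three]
  simp
  rw [zpow_add_one₀ g0]
  ring

/-- `x₂ + y₂ = 1` on the atom integrand. [folklore] -/
theorem atomFun_split_s22 : atomFun a e x = atomFun (fun i => a i + (if i = 2 then 1 else 0)) e x + atomFun a (fun i j => e i j + (if i = 2 ∧ j = 2 then 1 else 0)) x := by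
  have g0 := (one_sub_coord_pos hx 0).ne'; have g1 := (one_sub_coord_pos hx 1).ne'
  have g2 := (one_sub_coord_pos hx 2).ne'
  have g01 := (one_sub_mul_pos hx 0 1).ne'; have g12 := (one_sub_mul_pos hx 1 2).ne'
  simp only [atomFun_three]
  simp
  rw [zpow_add_one₀ g2]
  ring

/-- `x₁x₂ + y₁₂ = 1` on the atom integrand. [folklore] -/
theorem atomFun_split_s12 : atomFun a e x = atomFun (fun i => a i + (if i = 0 then 0 else 1)) e x + atomFun a (fun i j => e i j + (if i = 1 ∧ j = 2 then 1 else 0)) x := by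
  have g0 := (one_sub_coord_pos hx 0).ne'; have g1 := (one_sub_coord_pos hx 1).ne'
  have g2 := (one_sub_coord_pos hx 2).ne'
  have g01 := (one_sub_mul_pos hx 0 1).ne'; have g12 := (one_sub_mul_pos hx 1 2).ne'
  simp only [atomFun_three]
  simp
  rw [zpow_add_one₀ g12]
  ring

end identities

/-! ### Dominated pieces and the generic split -/

/-- **A piece of an atom is an atom.** If `s = [□³, q·atomFun a e]` and `atomFun a' e' ≤ atomFun a e` on
the cube, then `[□³, q·atomFun a' e']` is an integral representation (absolute convergence by
domination). [folklore] -/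
theorem exists_atomRep_of_le {a a' : Fin 3 → ℕ} {e e' : Fin 3 → Fin 3 → ℤ} {q : ℚ} {s : KZ.IntegralRep 3}
    (hs : (s.domain = {x : Fin 3 → ℝ | ∀ i, x i ∈ Set.Ioo (0:ℝ) 1} ∧
      Set.EqOn s.integrand (fun x => (q : ℝ) * atomFun a e x) s.domain))
    (hle : ∀ x : Fin 3 → ℝ, (∀ i, x i ∈ Set.Ioo (0:ℝ) 1) → atomFun a' e' x ≤ atomFun a e x) :
    ∃ s' : KZ.IntegralRep 3, (s'.domain = {x : Fin 3 → ℝ | ∀ i, x i ∈ Set.Ioo (0:ℝ) 1} ∧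
      Set.EqOn s'.integrand (fun x => (q : ℝ) * atomFun a' e' x) s'.domain) ∧
      s'.integrand = fun x => (q : ℝ) * atomFun a' e' x := by
  obtain ⟨hdom, hint⟩ := hs
  have hW : IsSemialgebraic ℚ {x : Fin 3 → ℝ | ∀ i, x i ∈ Set.Ioo (0:ℝ) 1} :=
    isSemialgebraic_openUnitCube
  have hmeas : MeasurableSet {x : Fin 3 → ℝ | ∀ i, x i ∈ Set.Ioo (0:ℝ) 1} :=
    IsSemialgebraic.measurableSet_holds hW
  have hsa : IsSemialgebraicFunOn ℚ {x : Fin 3 → ℝ | ∀ i, x i ∈ Set.Ioo (0:ℝ) 1}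
      fun x => (q : ℝ) * atomFun a' e' x :=
    (isSemialgebraicFunOn_const_ratCast hW q).fun_mul
      (isSemialgebraicFunOn_atomFun_comp (d := 3) hW a' e' (X := id)
        (fun i => isSemialgebraicFunOn_apply hW i))
  have hv : IntegrableOn (fun x => (q : ℝ) * atomFun a e x) {x : Fin 3 → ℝ | ∀ i, x i ∈ Set.Ioo (0:ℝ) 1} := by
    have := s.integrableOn.congr_fun hint (KZ.IntegralRep.measurableSet_domain_holds s)
    rwa [hdom] at this
  have hw : IntegrableOn (fun x => (q : ℝ) * atomFun a' e' x) {x : Fin 3 → ℝ | ∀ i, x i ∈ Set.Ioo (0:ℝ) 1} := by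
    refine Integrable.mono' hv.norm (KZ.aestronglyMeasurable_of_isSemialgebraicFunOn hsa hmeas) ?_
    refine (ae_restrict_iff' hmeas).2 (Filter.Eventually.of_forall fun x hx => ?_)
    rw [Real.norm_eq_abs, Real.norm_eq_abs, abs_mul, abs_mul, abs_of_pos (atomFun_three_pos hx a' e'),
      abs_of_pos (atomFun_three_pos hx a e)]
    exact mul_le_mul_of_nonneg_left (hle x hx) (abs_nonneg _)
  exact ⟨⟨_, _, hW, hsa, hw⟩, ⟨rfl, fun _ _ => rfl⟩, rfl⟩

/-- **The generic rule-1b split of a cube atom.** If `atomFun a e = atomFun a₁ e₁ + atomFun a₂ e₂` on the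
cube, then `[□³, q·atomFun a e] ≡ [□³, q·atomFun a₁ e₁] + [□³, q·atomFun a₂ e₂]` modulo `KZ.relations`.
[cite: KontsevichZagier2001, §1.2 rule (1)] -/
theorem atom_split_three {a a₁ a₂ : Fin 3 → ℕ} {e e₁ e₂ : Fin 3 → Fin 3 → ℤ} {q : ℚ} {s : KZ.IntegralRep 3}
    (hs : (s.domain = {x : Fin 3 → ℝ | ∀ i, x i ∈ Set.Ioo (0:ℝ) 1} ∧
      Set.EqOn s.integrand (fun x => (q : ℝ) * atomFun a e x) s.domain))
    (hid : ∀ x : Fin 3 → ℝ, (∀ i, x i ∈ Set.Ioo (0:ℝ) 1) →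
      atomFun a e x = atomFun a₁ e₁ x + atomFun a₂ e₂ x) :
    ∃ s₁ s₂ : KZ.IntegralRep 3, (s₁.domain = {x : Fin 3 → ℝ | ∀ i, x i ∈ Set.Ioo (0:ℝ) 1} ∧
      Set.EqOn s₁.integrand (fun x => (q : ℝ) * atomFun a₁ e₁ x) s₁.domain) ∧
      (s₂.domain = {x : Fin 3 → ℝ | ∀ i, x i ∈ Set.Ioo (0:ℝ) 1} ∧
      Set.EqOn s₂.integrand (fun x => (q : ℝ) * atomFun a₂ e₂ x) s₂.domain) ∧
      KZ.of s - KZ.of s₁ - KZ.of s₂ ∈ KZ.relations := by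
  have h1 : ∀ x : Fin 3 → ℝ, (∀ i, x i ∈ Set.Ioo (0:ℝ) 1) → atomFun a₁ e₁ x ≤ atomFun a e x :=
    fun x hx => by rw [hid x hx]; exact le_add_of_nonneg_right (atomFun_three_pos hx a₂ e₂).le
  have h2 : ∀ x : Fin 3 → ℝ, (∀ i, x i ∈ Set.Ioo (0:ℝ) 1) → atomFun a₂ e₂ x ≤ atomFun a e x :=
    fun x hx => by rw [hid x hx]; exact le_add_of_nonneg_left (atomFun_three_pos hx a₁ e₁).le
  obtain ⟨s₁, hs₁, hi₁⟩ := exists_atomRep_of_le hs h1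
  obtain ⟨s₂, hs₂, hi₂⟩ := exists_atomRep_of_le hs h2
  refine ⟨s₁, s₂, hs₁, hs₂, KZ.integrandAddRel_subset_relations ⟨3, s, s₁, s₂, ?_, ?_, fun x hx => ?_, rfl⟩⟩
  · rw [hs₁.1, hs.1]
  · rw [hs₂.1, hs.1]
  · rw [hs.2 hx, hi₁, hi₂, Pi.add_apply]
    rw [hs.1] at hx
    show (q : ℝ) * atomFun a e x = _
    rw [hid x hx, mul_add]

/-! ### The five moves as KZ relations -/

/-- `y₀₁ = y₀ + x₀y₁` on a cube atom of dimension three. [cite: KontsevichZagier2001, §1.2 rule (1)] -/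
theorem atomMove_n01 {a : Fin 3 → ℕ} {e : Fin 3 → Fin 3 → ℤ} {q : ℚ} {s : KZ.IntegralRep 3}
    (hs : (s.domain = {x : Fin 3 → ℝ | ∀ i, x i ∈ Set.Ioo (0:ℝ) 1} ∧
      Set.EqOn s.integrand (fun x => (q : ℝ) * atomFun a e x) s.domain)) :
    ∃ s₁ s₂ : KZ.IntegralRep 3,
      (s₁.domain = {x : Fin 3 → ℝ | ∀ i, x i ∈ Set.Ioo (0:ℝ) 1} ∧
      Set.EqOn s₁.integrand (fun x => (q : ℝ) * atomFun a (fun i j => e i j + (if i = 0 ∧ j = 0 then 1 else if i = 0 ∧ j = 1 then -1 else 0)) x) s₁.domain) ∧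
      (s₂.domain = {x : Fin 3 → ℝ | ∀ i, x i ∈ Set.Ioo (0:ℝ) 1} ∧
      Set.EqOn s₂.integrand (fun x => (q : ℝ) * atomFun (fun i => a i + (if i = 0 then 1 else 0)) (fun i j => e i j + (if i = 1 ∧ j = 1 then 1 else if i = 0 ∧ j = 1 then -1 else 0)) x) s₂.domain) ∧
      KZ.of s - KZ.of s₁ - KZ.of s₂ ∈ KZ.relations :=
  atom_split_three hs fun _ hx => atomFun_split_n01 a e hx

/-- `y₁₂ = y₂ + x₂y₁` on a cube atom of dimension three. [cite: KontsevichZagier2001, §1.2 rule (1)] -/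
theorem atomMove_n12 {a : Fin 3 → ℕ} {e : Fin 3 → Fin 3 → ℤ} {q : ℚ} {s : KZ.IntegralRep 3}
    (hs : (s.domain = {x : Fin 3 → ℝ | ∀ i, x i ∈ Set.Ioo (0:ℝ) 1} ∧
      Set.EqOn s.integrand (fun x => (q : ℝ) * atomFun a e x) s.domain)) :
    ∃ s₁ s₂ : KZ.IntegralRep 3,
      (s₁.domain = {x : Fin 3 → ℝ | ∀ i, x i ∈ Set.Ioo (0:ℝ) 1} ∧
      Set.EqOn s₁.integrand (fun x => (q : ℝ) * atomFun a (fun i j => e i j + (if i = 2 ∧ j = 2 then 1 else if i = 1 ∧ j = 2 then -1 else 0)) x) s₁.domain) ∧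
      (s₂.domain = {x : Fin 3 → ℝ | ∀ i, x i ∈ Set.Ioo (0:ℝ) 1} ∧
      Set.EqOn s₂.integrand (fun x => (q : ℝ) * atomFun (fun i => a i + (if i = 2 then 1 else 0)) (fun i j => e i j + (if i = 1 ∧ j = 1 then 1 else if i = 1 ∧ j = 2 then -1 else 0)) x) s₂.domain) ∧
      KZ.of s - KZ.of s₁ - KZ.of s₂ ∈ KZ.relations :=
  atom_split_three hs fun _ hx => atomFun_split_n12 a e hx

/-- `x₀ + y₀ = 1` on a cube atom of dimension three. [cite: KontsevichZagier2001, §1.2 rule (1)] -/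
theorem atomMove_s00 {a : Fin 3 → ℕ} {e : Fin 3 → Fin 3 → ℤ} {q : ℚ} {s : KZ.IntegralRep 3}
    (hs : (s.domain = {x : Fin 3 → ℝ | ∀ i, x i ∈ Set.Ioo (0:ℝ) 1} ∧
      Set.EqOn s.integrand (fun x => (q : ℝ) * atomFun a e x) s.domain)) :
    ∃ s₁ s₂ : KZ.IntegralRep 3,
      (s₁.domain = {x : Fin 3 → ℝ | ∀ i, x i ∈ Set.Ioo (0:ℝ) 1} ∧
      Set.EqOn s₁.integrand (fun x => (q : ℝ) * atomFun (fun i => a i + (if i = 0 then 1 else 0)) e x) s₁.domain) ∧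
      (s₂.domain = {x : Fin 3 → ℝ | ∀ i, x i ∈ Set.Ioo (0:ℝ) 1} ∧
      Set.EqOn s₂.integrand (fun x => (q : ℝ) * atomFun a (fun i j => e i j + (if i = 0 ∧ j = 0 then 1 else 0)) x) s₂.domain) ∧
      KZ.of s - KZ.of s₁ - KZ.of s₂ ∈ KZ.relations :=
  atom_split_three hs fun _ hx => atomFun_split_s00 a e hx

/-- `x₂ + y₂ = 1` on a cube atom of dimension three. [cite: KontsevichZagier2001, §1.2 rule (1)] -/
theorem atomMove_s22 {a : Fin 3 → ℕ} {e : Fin 3 → Fin 3 → ℤ} {q : ℚ} {s : KZ.IntegralRep 3}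
    (hs : (s.domain = {x : Fin 3 → ℝ | ∀ i, x i ∈ Set.Ioo (0:ℝ) 1} ∧
      Set.EqOn s.integrand (fun x => (q : ℝ) * atomFun a e x) s.domain)) :
    ∃ s₁ s₂ : KZ.IntegralRep 3,
      (s₁.domain = {x : Fin 3 → ℝ | ∀ i, x i ∈ Set.Ioo (0:ℝ) 1} ∧
      Set.EqOn s₁.integrand (fun x => (q : ℝ) * atomFun (fun i => a i + (if i = 2 then 1 else 0)) e x) s₁.domain) ∧
      (s₂.domain = {x : Fin 3 → ℝ | ∀ i, x i ∈ Set.Ioo (0:ℝ) 1} ∧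
      Set.EqOn s₂.integrand (fun x => (q : ℝ) * atomFun a (fun i j => e i j + (if i = 2 ∧ j = 2 then 1 else 0)) x) s₂.domain) ∧
      KZ.of s - KZ.of s₁ - KZ.of s₂ ∈ KZ.relations :=
  atom_split_three hs fun _ hx => atomFun_split_s22 a e hx


/-- `x₁x₂ + y₁₂ = 1` on a cube atom of dimension three. [cite: KontsevichZagier2001, §1.2 rule (1)] -/
theorem atomMove_s12 {a : Fin 3 → ℕ} {e : Fin 3 → Fin 3 → ℤ} {q : ℚ} {s : KZ.IntegralRep 3}
    (hs : (s.domain = {x : Fin 3 → ℝ | ∀ i, x i ∈ Set.Ioo (0:ℝ) 1} ∧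
      Set.EqOn s.integrand (fun x => (q : ℝ) * atomFun a e x) s.domain)) :
    ∃ s₁ s₂ : KZ.IntegralRep 3,
      (s₁.domain = {x : Fin 3 → ℝ | ∀ i, x i ∈ Set.Ioo (0:ℝ) 1} ∧
      Set.EqOn s₁.integrand (fun x => (q : ℝ) * atomFun (fun i => a i + (if i = 0 then 0 else 1)) e x) s₁.domain) ∧
      (s₂.domain = {x : Fin 3 → ℝ | ∀ i, x i ∈ Set.Ioo (0:ℝ) 1} ∧
      Set.EqOn s₂.integrand (fun x => (q : ℝ) * atomFun a (fun i j => e i j + (if i = 1 ∧ j = 2 then 1 else 0)) x) s₂.domain) ∧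
      KZ.of s - KZ.of s₁ - KZ.of s₂ ∈ KZ.relations :=
  atom_split_three hs fun _ hx => atomFun_split_s12 a e hx

/-- **The shift `x₁x₂ + y₁₂ = 1` on a dimension-three cube atom** (registered tool stub `atomShiftThree12`):
`[a; e] ≡ [a + 𝟙_{[1,2]}; e] + [a; e + δ_{[1,2]}]`. [cite: KontsevichZagier2001, §1.2 rule (1)] -/
theorem atomShiftThree12 : ∀ (q : ℚ) (a : Fin 3 → ℕ) (e : Fin 3 → Fin 3 → ℤ) (s : Literature.NumberTheory.Transcendental.KZ.IntegralRep 3), s.domain = {x : Fin 3 → ℝ | ∀ i, x i ∈ Set.Ioo (0:ℝ) 1} → Set.EqOn s.integrand (fun x => (q : ℝ) * ((∏ i : Fin 3, x i ^ a i) * ∏ i : Fin 3, ∏ j : Fin 3, if i ≤ j then (1 - (∏ l : Fin 3, if i ≤ l ∧ l ≤ j then x l else 1)) ^ e i j else 1)) s.domain → ∃ s₁ s₂ : Literature.NumberTheory.Transcendental.KZ.IntegralRep 3, (s₁.domain = {x : Fin 3 → ℝ | ∀ i, x i ∈ Set.Ioo (0:ℝ) 1} ∧ Set.EqOn s₁.integrand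 (fun x => (q : ℝ) * ((∏ i : Fin 3, x i ^ (a i + (if i = 0 then 0 else 1))) * ∏ i : Fin 3, ∏ j : Fin 3, if i ≤ j then (1 - (∏ l : Fin 3, if i ≤ l ∧ l ≤ j then x l else 1)) ^ e i j else 1)) s₁.domain) ∧ (s₂.domain = {x : Fin 3 → ℝ | ∀ i, x i ∈ Set.Ioo (0:ℝ) 1} ∧ Set.EqOn s₂.integrand (fun x => (q : ℝ) * ((∏ i : Fin 3, x i ^ a i) * ∏ i : Fin 3, ∏ j : Fin 3, if i ≤ j then (1 - (∏ l : Fin 3, if i ≤ l ∧ l ≤ j then x l else 1)) ^ (e i j + (if i = 1 ∧ j = 2 then 1 else 0)) else 1)) s₂.domain) ∧ Literature.NumberTheory.Transcendental.KZ.of s - Literature.NumberTheory.Transcendental.KZ.of s₁ - Literature.NumberTheory.Transcendental.KZ.of s₂ ∈ Literature.NumberTheory.Transcendental.KZ.relations := by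
  intro q a e s hdom hint
  exact atom_split_three (q := q) ⟨hdom, hint⟩ fun _ hx => atomFun_split_s12 a e hx

end Summit.KontsevichZagierPeriods.DihedralNormalForm.TorusDescent
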